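import Mathlib.Analysis.Convex.SpecificFunctions.Basic
import Summits.MatrixMultiplication.MatrixMultiplication.Theorems.FarEdgeDescentChainCapSteps

/-!
# Far-edge descent, kernel XLI-B — tools for the pair criterion of the tree cap: dyadic tangents, the unbalanced regime, and the reduction to one vertex inequality (model level)

Kernel XLI-A (`FarEdgeDescentTreeCap.tree_cap`) caps every floor-respecting product tree at
Schönhage's order `κ_S = log₂(4/3)` given the PAIR CRITERION
`(1−(β−1)λ')Φx^{κ_S} + (1−(β−1)λ)Φ'(1−x)^{κ_S} ≤ Φ_P` over a polytope of (share, potential) pairs and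
all size ratios `x ∈ [0,1]`.  This file supplies what is needed to DISCHARGE it:
* `kappaS_le`, `kappaS_ge`: `17/41 ≤ κ_S ≤ 22/53` (from `(4/3)^41 ≥ 2^17`, `(4/3)^53 ≤ 2^22`);
  `two_rpow_kappaS`, `half_rpow_kappaS`, `quarter_rpow_kappaS`: `2^{κ_S} = 4/3`, `(1/2)^{κ_S} = 3/4`,
  `(1/4)^{κ_S} = 9/16` — the dyadic points where `x^{κ_S}` is rational;
* `rpow_tangent`: the tangent bound of the concave power, `t^k ≤ (1−k)ρ + k(ρ/x₀)t` for
  `0 ≤ k ≤ 1`, `x₀ > 0`, `x₀^k ≤ ρ` (Bernoulli, `rpow_one_add_le_one_add_mul_self`), and the MENU bound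
  `pair_menu`: `a·x^k + b·(1−x)^k ≤ (1−k)(ρa + τb) + k·max(ρa/x₀, τb/y₀)`;
* `pair_unbalanced`: if `(9/4)·b ≤ a` then `a·x^{κ_S} + b·(1−x)^{κ_S} ≤ a + (1−κ_S)(9/16)·b` (tangents
  at `x₀ = 1`, `y₀ = 1/4`), whence `criterion_unbalanced`: the pair criterion holds at every point of
  its polytope with `(9/4)·(1−(β−1)λ)Φ' ≤ (1−(β−1)λ')Φ` as soon as `(1−κ_S)(9/16)(1−(β−1)λ) ≤ 1−βλ`
  on the heavy window (true for `β = 3/2`: `criterion_unbalanced_three_halves_cond`) — the margin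
  `Φ_P − (1−(β−1)λ')Φ ≥ (1−βλ)Φ'` of a light partner always pays for its own term;
* `criterion_of_vertex`: the criterion's left side is AFFINE in `(Φ, Φ')` for fixed shares and `x`, so
  it suffices to check the two extreme vertices of the polytope; by the symmetry
  `(λ,λ',x) ↔ (λ',λ,1−x)` ONE inequality in the two shares remains:
  `H(λ,λ',x): (1−(β−1)λ')·Mλ(1−βλ)·x^{κ_S} + (1−(β−1)λ)·λ'(M(1−(β−1)λ) − (1+ε)λ)·(1−x)^{κ_S}
             ≤ M(1−βλ)(λ + λ' − (2β−1)λλ')`, `M = 1+ε−V_min`,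
  for all heavy `λ, λ'` and `x ∈ [0,1]` (vertex `Φ = Mλ`, `Φ' = λ'(M(1−(β−1)λ) − (1+ε)λ)/(1−βλ)`:
  the factor at the floor times the partner that puts the product exactly on the floor).
Memo NODE-g61 §2: at `β = 3/2`, `ε = 1/100`, `V_min = 1/7` the vertex inequality holds with worst
ratio `0.956` on the balanced band and is covered by `criterion_unbalanced` elsewhere; its cell-wise
certification (half-dyadic menu, slack `2.3%`) is the remaining finite check.

HONEST FRAMING: MODEL level, elementary real analysis; no `sorry`, no axioms, no definitions.
References: kernels XL-B/D, XLI-A; Schönhage 1981 [Schonhage1981].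
-/

noncomputable section

set_option linter.dupNamespace false

namespace Summit.MatrixMultiplication.MatrixMultiplication.Theorems.FarEdgeDescentTreeCapTools

open Summit.MatrixMultiplication.MatrixMultiplication.Theorems.FarEdgeDescentChainCapSteps

/-! ## The exponent `κ_S = log₂(4/3)` -/

/-- `κ_S ≤ 22/53` (`(4/3)^53 ≤ 2^22`). -/
theorem kappaS_le : Real.log (4 / 3) / Real.log 2 ≤ 22 / 53 := by
  have h2 : 0 < Real.log 2 := Real.log_pos (by norm_num)
  rw [div_le_iff₀ h2]
  have key : Real.log ((4 / 3 : ℝ) ^ 53) ≤ Real.log ((2 : ℝ) ^ 22) :=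
    Real.log_le_log (by positivity) (by norm_num)
  rw [Real.log_pow, Real.log_pow] at key
  push_cast at key
  linarith

/-- `17/41 ≤ κ_S` (`2^17 ≤ (4/3)^41`). -/
theorem kappaS_ge : 17 / 41 ≤ Real.log (4 / 3) / Real.log 2 := by
  have h2 : 0 < Real.log 2 := Real.log_pos (by norm_num)
  rw [le_div_iff₀ h2]
  have key : Real.log ((2 : ℝ) ^ 17) ≤ Real.log ((4 / 3 : ℝ) ^ 41) :=
    Real.log_le_log (by positivity) (by norm_num)
  rw [Real.log_pow, Real.log_pow] at key
  push_cast at key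
  linarith

/-- `κ_S ≤ 1`. -/
theorem kappaS_le_one : Real.log (4 / 3) / Real.log 2 ≤ 1 := kappaS_le.trans (by norm_num)

/-- `2^{κ_S} = 4/3`. -/
theorem two_rpow_kappaS : (2 : ℝ) ^ (Real.log (4 / 3) / Real.log 2) = 4 / 3 := by
  rw [Real.rpow_def_of_pos (by norm_num : (0:ℝ) < 2), mul_comm, kappaS_mul_log_two,
    Real.exp_log (by norm_num)]

/-- `(1/2)^{κ_S} = 3/4`. -/
theorem half_rpow_kappaS : (1 / 2 : ℝ) ^ (Real.log (4 / 3) / Real.log 2) = 3 / 4 := by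
  rw [one_div, Real.inv_rpow (by norm_num : (0:ℝ) ≤ 2), two_rpow_kappaS]
  norm_num

/-- `(1/4)^{κ_S} = 9/16`. -/
theorem quarter_rpow_kappaS : (1 / 4 : ℝ) ^ (Real.log (4 / 3) / Real.log 2) = 9 / 16 := by
  have h : (1 / 4 : ℝ) = (1 / 2) * (1 / 2) := by norm_num
  rw [h, Real.mul_rpow (by norm_num) (by norm_num), half_rpow_kappaS]
  norm_num

/-! ## Tangent (menu) bounds for the concave power -/

/-- **Tangent bound.**  For `0 ≤ k ≤ 1`, `x₀ > 0` with `x₀^k ≤ ρ` and `t ≥ 0`: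
`t^k ≤ (1−k)·ρ + k·(ρ/x₀)·t` (the tangent of the concave `t ↦ t^k` at `x₀`, with `x₀^k`
replaced by its upper bound `ρ`). -/
theorem rpow_tangent {k x₀ ρ t : ℝ} (hk0 : 0 ≤ k) (hk1 : k ≤ 1) (hx₀ : 0 < x₀) (hρ : x₀ ^ k ≤ ρ)
    (ht : 0 ≤ t) : t ^ k ≤ (1 - k) * ρ + k * (ρ / x₀) * t := by
  have hx0k : 0 ≤ x₀ ^ k := Real.rpow_nonneg hx₀.le k
  have h1 : t = x₀ * (t / x₀) := by field_simp
  have hB : (t / x₀) ^ k ≤ 1 + k * (t / x₀ - 1) := by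
    have := rpow_one_add_le_one_add_mul_self (show (-1:ℝ) ≤ t / x₀ - 1 by
      have : 0 ≤ t / x₀ := div_nonneg ht hx₀.le
      linarith) hk0 hk1
    simpa using this
  have h2 : t ^ k = x₀ ^ k * (t / x₀) ^ k := by
    rw [h1, Real.mul_rpow hx₀.le (div_nonneg ht hx₀.le), ← h1]
  rw [h2]
  have h3 : x₀ ^ k * (t / x₀) ^ k ≤ x₀ ^ k * (1 + k * (t / x₀ - 1)) :=
    mul_le_mul_of_nonneg_left hB hx0k
  have h4 : x₀ ^ k * (1 + k * (t / x₀ - 1)) = (1 - k) * x₀ ^ k + k * (t / x₀) * x₀ ^ k := by ring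
  have h5 : (1 - k) * x₀ ^ k ≤ (1 - k) * ρ := mul_le_mul_of_nonneg_left hρ (by linarith)
  have h6 : k * (t / x₀) * x₀ ^ k ≤ k * (t / x₀) * ρ :=
    mul_le_mul_of_nonneg_left hρ (mul_nonneg hk0 (div_nonneg ht hx₀.le))
  have h7 : k * (t / x₀) * ρ = k * (ρ / x₀) * t := by field_simp
  linarith

/-- **Menu bound.**  For `a, b ≥ 0`, `x ∈ [0,1]`, tangent points `x₀, y₀ > 0` with `x₀^k ≤ ρ`,
`y₀^k ≤ τ`: `a·x^k + b·(1−x)^k ≤ (1−k)(ρa + τb) + k·max(ρa/x₀, τb/y₀)`. -/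
theorem pair_menu {k x₀ y₀ ρ τ a b x : ℝ} (hk0 : 0 ≤ k) (hk1 : k ≤ 1) (hx₀ : 0 < x₀)
    (hy₀ : 0 < y₀) (hρ : x₀ ^ k ≤ ρ) (hτ : y₀ ^ k ≤ τ) (ha : 0 ≤ a) (hb : 0 ≤ b) (hx0 : 0 ≤ x)
    (hx1 : x ≤ 1) :
    a * x ^ k + b * (1 - x) ^ k ≤ (1 - k) * (ρ * a + τ * b) + k * max (ρ * a / x₀) (τ * b / y₀) := by
  have h1 := rpow_tangent hk0 hk1 hx₀ hρ hx0
  have h2 := rpow_tangent hk0 hk1 hy₀ hτ (show 0 ≤ 1 - x by linarith)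
  have h3 : a * x ^ k ≤ a * ((1 - k) * ρ + k * (ρ / x₀) * x) := mul_le_mul_of_nonneg_left h1 ha
  have h4 : b * (1 - x) ^ k ≤ b * ((1 - k) * τ + k * (τ / y₀) * (1 - x)) :=
    mul_le_mul_of_nonneg_left h2 hb
  have hm1 : ρ * a / x₀ ≤ max (ρ * a / x₀) (τ * b / y₀) := le_max_left _ _
  have hm2 : τ * b / y₀ ≤ max (ρ * a / x₀) (τ * b / y₀) := le_max_right _ _
  have h5 : k * (ρ / x₀) * x * a + k * (τ / y₀) * (1 - x) * b ≤
      k * max (ρ * a / x₀) (τ * b / y₀) := by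
    have e1 : k * (ρ / x₀) * x * a = (k * x) * (ρ * a / x₀) := by ring
    have e2 : k * (τ / y₀) * (1 - x) * b = (k * (1 - x)) * (τ * b / y₀) := by ring
    rw [e1, e2]
    have := mul_le_mul_of_nonneg_left hm1 (mul_nonneg hk0 hx0)
    have := mul_le_mul_of_nonneg_left hm2 (mul_nonneg hk0 (show 0 ≤ 1 - x by linarith))
    nlinarith
  nlinarith

/-- The menu bound with the rational enclosure `17/41 ≤ κ_S ≤ 22/53`. -/
theorem pair_menu_kappaS {x₀ y₀ ρ τ a b x : ℝ} (hx₀ : 0 < x₀) (hy₀ : 0 < y₀)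
    (hρ : x₀ ^ (Real.log (4 / 3) / Real.log 2) ≤ ρ) (hτ : y₀ ^ (Real.log (4 / 3) / Real.log 2) ≤ τ)
    (ha : 0 ≤ a) (hb : 0 ≤ b) (hx0 : 0 ≤ x) (hx1 : x ≤ 1) :
    a * x ^ (Real.log (4 / 3) / Real.log 2) + b * (1 - x) ^ (Real.log (4 / 3) / Real.log 2) ≤
      (24 / 41) * (ρ * a + τ * b) + (22 / 53) * max (ρ * a / x₀) (τ * b / y₀) := by
  have hk0 : 0 ≤ Real.log (4 / 3) / Real.log 2 := kappaS_nonneg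
  have h := pair_menu hk0 kappaS_le_one hx₀ hy₀ hρ hτ ha hb hx0 hx1
  have hρ0 : 0 ≤ ρ := (Real.rpow_nonneg hx₀.le _).trans hρ
  have hτ0 : 0 ≤ τ := (Real.rpow_nonneg hy₀.le _).trans hτ
  have hS0 : 0 ≤ ρ * a + τ * b := by positivity
  have hM0 : 0 ≤ max (ρ * a / x₀) (τ * b / y₀) :=
    le_max_of_le_left (div_nonneg (mul_nonneg hρ0 ha) hx₀.le)
  have h1 : (1 - Real.log (4 / 3) / Real.log 2) * (ρ * a + τ * b) ≤ 24 / 41 * (ρ * a + τ * b) :=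
    mul_le_mul_of_nonneg_right (by linarith [kappaS_ge]) hS0
  have h2 : Real.log (4 / 3) / Real.log 2 * max (ρ * a / x₀) (τ * b / y₀) ≤
      22 / 53 * max (ρ * a / x₀) (τ * b / y₀) := mul_le_mul_of_nonneg_right kappaS_le hM0
  linarith

/-- An upper bound `ρ` for `x₀^{κ_S}` (`0 < x₀ ≤ 1`) is certified by `x₀^17 ≤ ρ^41`, `ρ > 0`. -/
theorem rpow_kappaS_le_of_pow {x₀ ρ : ℝ} (hx₀ : 0 < x₀) (hx₁ : x₀ ≤ 1) (hρ : 0 < ρ)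
    (h : x₀ ^ (17:ℕ) ≤ ρ ^ (41:ℕ)) : x₀ ^ (Real.log (4 / 3) / Real.log 2) ≤ ρ := by
  have h1 : x₀ ^ (Real.log (4 / 3) / Real.log 2) ≤ x₀ ^ ((17:ℝ) / 41) :=
    Real.rpow_le_rpow_of_exponent_ge hx₀ hx₁ kappaS_ge
  refine h1.trans ?_
  -- x₀^(17/41) ≤ ρ  ⟸  (x₀^(17/41))^41 = x₀^17 ≤ ρ^41
  have h2 : (x₀ ^ ((17:ℝ) / 41)) ^ (41:ℕ) = x₀ ^ (17:ℕ) := by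
    rw [← Real.rpow_natCast, ← Real.rpow_mul hx₀.le]
    norm_num
  have h3 : 0 ≤ x₀ ^ ((17:ℝ) / 41) := Real.rpow_nonneg hx₀.le _
  by_contra hlt
  push Not at hlt
  have : ρ ^ (41:ℕ) < (x₀ ^ ((17:ℝ) / 41)) ^ (41:ℕ) := pow_lt_pow_left₀ hlt hρ.le (by norm_num)
  rw [h2] at this
  linarith

/-! ## The unbalanced regime -/

/-- **Unbalanced pairs.**  If `(9/4)·b ≤ a` (`b ≥ 0`) then for all `x ∈ [0,1]`:
`a·x^{κ_S} + b·(1−x)^{κ_S} ≤ a + (1−κ_S)·(9/16)·b` (tangents at `x₀ = 1`, `y₀ = 1/4`, where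
`(1/4)^{κ_S} = 9/16` and the slopes balance at `a = (9/4)b`). -/
theorem pair_unbalanced {a b x : ℝ} (hb : 0 ≤ b) (hab : 9 / 4 * b ≤ a) (hx0 : 0 ≤ x)
    (hx1 : x ≤ 1) :
    a * x ^ (Real.log (4 / 3) / Real.log 2) + b * (1 - x) ^ (Real.log (4 / 3) / Real.log 2) ≤
      a + (1 - Real.log (4 / 3) / Real.log 2) * (9 / 16) * b := by
  set k := Real.log (4 / 3) / Real.log 2 with hk
  have ha : 0 ≤ a := by linarith
  have hρ : (1:ℝ) ^ k ≤ 1 := by rw [Real.one_rpow]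
  have hτ : (1 / 4 : ℝ) ^ k ≤ 9 / 16 := by rw [hk, quarter_rpow_kappaS]
  have h := pair_menu kappaS_nonneg kappaS_le_one (by norm_num : (0:ℝ) < 1)
    (by norm_num : (0:ℝ) < 1 / 4) hρ hτ ha hb hx0 hx1
  have e1 : (1:ℝ) * a / 1 = a := by ring
  have e2 : (9:ℝ) / 16 * b / (1 / 4) = 9 / 4 * b := by ring
  rw [e1, e2, max_eq_left hab] at h
  have : (1 - k) * (1 * a + 9 / 16 * b) + k * a = a + (1 - k) * (9 / 16) * b := by ring
  linarith

/-- **The criterion in the unbalanced regime.**  At any point of the criterion's polytope with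
`(9/4)·(1−(β−1)λ)Φ' ≤ (1−(β−1)λ')Φ`, the pair inequality holds provided
`(1−κ_S)(9/16)·(1−(β−1)λ) ≤ 1−βλ`: the margin `Φ_P − (1−(β−1)λ')Φ ≥ (1−βλ)Φ'` (from `Φ ≤ (1+ε)λ`)
pays for the partner's term. -/
theorem criterion_unbalanced {β ε lA lB PA PB x : ℝ} (hlB : 0 ≤ lB)
    (hPA1 : PA ≤ (1 + ε) * lA) (hPB0 : 0 ≤ PB) (hnA : 0 ≤ 1 - (β - 1) * lA)
    (hcond : (1 - Real.log (4 / 3) / Real.log 2) * (9 / 16) * (1 - (β - 1) * lA) ≤ 1 - β * lA)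
    (hab : 9 / 4 * ((1 - (β - 1) * lA) * PB) ≤ (1 - (β - 1) * lB) * PA) (hx0 : 0 ≤ x)
    (hx1 : x ≤ 1) :
    (1 - (β - 1) * lB) * PA * x ^ (Real.log (4 / 3) / Real.log 2) +
        (1 - (β - 1) * lA) * PB * (1 - x) ^ (Real.log (4 / 3) / Real.log 2) ≤
      (1 - β * lB) * PA + (1 - β * lA) * PB + (1 + ε) * lA * lB := by
  have hb : 0 ≤ (1 - (β - 1) * lA) * PB := mul_nonneg hnA hPB0
  have h := pair_unbalanced hb hab hx0 hx1
  -- margin: RHS − a = (1−βlA)PB + lB((1+ε)lA − PA) ≥ (1−βlA)PB ≥ (1−κ)(9/16)(1−(β−1)lA)PB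
  have hm : (1 - Real.log (4 / 3) / Real.log 2) * (9 / 16) * ((1 - (β - 1) * lA) * PB) ≤
      (1 - β * lA) * PB := by
    have := mul_le_mul_of_nonneg_right hcond hPB0
    linarith
  have hm2 : 0 ≤ lB * ((1 + ε) * lA - PA) := mul_nonneg hlB (by linarith)
  nlinarith

/-- The side condition of `criterion_unbalanced` holds on the heavy window at `β = 3/2`:
`(1−κ_S)(9/16)(1 − λ/2) ≤ 1 − 3λ/2` for `λ ≤ 1/2`. -/
theorem criterion_unbalanced_three_halves_cond {lam : ℝ} (h1 : 2 * lam ≤ 1) :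
    (1 - Real.log (4 / 3) / Real.log 2) * (9 / 16) * (1 - ((3:ℝ) / 2 - 1) * lam) ≤
      1 - 3 / 2 * lam := by
  have hk := kappaS_ge
  have hn : 0 ≤ 1 - ((3:ℝ) / 2 - 1) * lam := by linarith
  have : (1 - Real.log (4 / 3) / Real.log 2) * (9 / 16) * (1 - ((3:ℝ) / 2 - 1) * lam) ≤
      (24 / 41) * (9 / 16) * (1 - ((3:ℝ) / 2 - 1) * lam) := by
    apply mul_le_mul_of_nonneg_right _ hn
    apply mul_le_mul_of_nonneg_right _ (by norm_num)
    linarith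
  nlinarith

/-! ## Reduction of the criterion to one vertex inequality -/

/-- **Vertex reduction.**  Let `1 < β`, `0 ≤ ε`, `0 ≤ V_min ≤ 1`, `M = 1+ε−V_min`.  If the VERTEX
INEQUALITY
`(1−(β−1)λ')·Mλ(1−βλ)·x^{κ_S} + (1−(β−1)λ)·λ'(M(1−(β−1)λ) − (1+ε)λ)·(1−x)^{κ_S} ≤ M(1−βλ)(λ+λ'−(2β−1)λλ')`
holds for all heavy `λ, λ'` and all `x ∈ [0,1]`, then the pair criterion of `tree_cap` holds. -/
theorem criterion_of_vertex {β ε Vmin : ℝ} (hβ : 1 < β) (hε : 0 ≤ ε) (hV0 : 0 ≤ Vmin)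
    (hV1 : Vmin ≤ 1)
    (hH : ∀ lA lB x : ℝ, 0 < lA → (2 * β - 1) * lA ≤ 1 → 0 < lB → (2 * β - 1) * lB ≤ 1 →
      0 ≤ x → x ≤ 1 →
      (1 - (β - 1) * lB) * ((1 + ε - Vmin) * lA) * (1 - β * lA) *
            x ^ (Real.log (4 / 3) / Real.log 2) +
          (1 - (β - 1) * lA) * (lB * ((1 + ε - Vmin) * (1 - (β - 1) * lA) - (1 + ε) * lA)) *
            (1 - x) ^ (Real.log (4 / 3) / Real.log 2) ≤
        (1 + ε - Vmin) * (1 - β * lA) * (lA + lB - (2 * β - 1) * lA * lB)) :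
    ∀ lA lB PA PB x : ℝ, 0 < lA → (2 * β - 1) * lA ≤ 1 → 0 < lB → (2 * β - 1) * lB ≤ 1 →
      0 ≤ PA → PA ≤ (1 + ε - Vmin) * lA → 0 ≤ PB → PB ≤ (1 + ε - Vmin) * lB →
      (1 - β * lB) * PA + (1 - β * lA) * PB + (1 + ε) * lA * lB ≤
        (1 + ε - Vmin) * (lA + lB - (2 * β - 1) * lA * lB) →
      0 ≤ x → x ≤ 1 →
      (1 - (β - 1) * lB) * PA * x ^ (Real.log (4 / 3) / Real.log 2) +
          (1 - (β - 1) * lA) * PB * (1 - x) ^ (Real.log (4 / 3) / Real.log 2) ≤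
        (1 - β * lB) * PA + (1 - β * lA) * PB + (1 + ε) * lA * lB := by
  intro lA lB PA PB x hlA0 hlA1 hlB0 hlB1 hPA0 hPA1 hPB0 hPB1 hline hx0 hx1
  set k := Real.log (4 / 3) / Real.log 2 with hk
  set M := 1 + ε - Vmin with hM
  set X := x ^ k with hX
  set Y := (1 - x) ^ k with hY
  have hX0 : 0 ≤ X := Real.rpow_nonneg hx0 k
  have hX1 : X ≤ 1 := Real.rpow_le_one hx0 hx1 kappaS_nonneg
  have hY0 : 0 ≤ Y := Real.rpow_nonneg (by linarith) k
  have hY1 : Y ≤ 1 := Real.rpow_le_one (by linarith) (by linarith) kappaS_nonneg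
  -- shares, dampings
  have hM0 : 0 ≤ M := by simp only [hM]; linarith
  have hqA : 0 < 1 - β * lA := by have := mul_pos (sub_pos.2 hβ) hlA0; linarith
  have hqB : 0 < 1 - β * lB := by have := mul_pos (sub_pos.2 hβ) hlB0; linarith
  have hnA : 0 ≤ 1 - (β - 1) * lA := by have := mul_pos (by linarith : (0:ℝ) < β) hlA0; linarith
  have hnB : 0 ≤ 1 - (β - 1) * lB := by have := mul_pos (by linarith : (0:ℝ) < β) hlB0; linarith
  set qA := 1 - β * lA with hqAdef
  set qB := 1 - β * lB with hqBdef
  set nA := 1 - (β - 1) * lA with hnAdef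
  set nB := 1 - (β - 1) * lB with hnBdef
  -- the affine coefficients
  set α := qB - nB * X with hα
  set β' := qA - nA * Y with hβ'
  have hC0 : 0 ≤ (1 + ε) * lA * lB := mul_nonneg (mul_nonneg (by linarith) hlA0.le) hlB0.le
  have hVm : (1 + ε) * lA * lB - lA * (M * lB) = Vmin * lA * lB := by simp only [hM]; ring
  have hVm0 : 0 ≤ Vmin * lA * lB := mul_nonneg (mul_nonneg hV0 hlA0.le) hlB0.le
  -- goal as nonnegativity of G = α PA + β' PB + (1+ε) lA lB
  suffices hG : 0 ≤ α * PA + β' * PB + (1 + ε) * lA * lB by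
    have : nB * PA * X + nA * PB * Y = qB * PA + qA * PB + (1 + ε) * lA * lB
        - (α * PA + β' * PB + (1 + ε) * lA * lB) := by
      simp only [hα, hβ']; ring
    linarith
  -- the two vertex facts (qA·G(P1) ≥ 0 and qB·G(P2) ≥ 0)
  have hP1 := hH lA lB x hlA0 hlA1 hlB0 hlB1 hx0 hx1
  have hP2 := hH lB lA (1 - x) hlB0 hlB1 hlA0 hlA1 (by linarith) (by linarith)
  have h1x : 1 - (1 - x) = x := by ring
  rw [h1x] at hP2
  have F1 : 0 ≤ qA * (α * (M * lA)) + β' * (lB * (M * nA - (1 + ε) * lA))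
      + qA * ((1 + ε) * lA * lB) := by
    have e : qA * (α * (M * lA)) + β' * (lB * (M * nA - (1 + ε) * lA))
        + qA * ((1 + ε) * lA * lB) =
        M * qA * (lA + lB - (2 * β - 1) * lA * lB)
        - (nB * (M * lA) * qA * X + nA * (lB * (M * nA - (1 + ε) * lA)) * Y) := by
      simp only [hα, hβ', hqAdef, hqBdef, hnAdef, hnBdef]; ring
    rw [e]
    linarith
  have F2 : 0 ≤ α * (lA * (M * nB - (1 + ε) * lB)) + qB * (β' * (M * lB))
      + qB * ((1 + ε) * lA * lB) := by
    have e : α * (lA * (M * nB - (1 + ε) * lB)) + qB * (β' * (M * lB))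
        + qB * ((1 + ε) * lA * lB) =
        M * qB * (lB + lA - (2 * β - 1) * lB * lA)
        - (nA * (M * lB) * qB * Y + nB * (lA * (M * nB - (1 + ε) * lB)) * X) := by
      simp only [hα, hβ', hqAdef, hqBdef, hnAdef, hnBdef]; ring
    rw [e]
    linarith
  -- the vertices lie on the floor line
  have L1 : lB * (M * nA - (1 + ε) * lA) =
      M * (lA + lB - (2 * β - 1) * lA * lB) - (1 + ε) * lA * lB - qB * (M * lA) := by
    simp only [hqBdef, hnAdef]; ring
  have L2 : lA * (M * nB - (1 + ε) * lB) =
      M * (lA + lB - (2 * β - 1) * lA * lB) - (1 + ε) * lA * lB - qA * (M * lB) := by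
    simp only [hqAdef, hnBdef]; ring
  -- lower bounds α ≥ −lB, β' ≥ −lA
  have hαl : -lB ≤ α := by
    have : nB * X ≤ nB := mul_le_of_le_one_right hnB hX1
    simp only [hα, hqBdef, hnBdef] at this ⊢; linarith
  have hβl : -lA ≤ β' := by
    have : nA * Y ≤ nA := mul_le_of_le_one_right hnA hY1
    simp only [hβ', hqAdef, hnAdef] at this ⊢; linarith
  -- case analysis on the signs of α, β'
  by_cases ha : 0 ≤ α
  · by_cases hb : 0 ≤ β'
    · -- both nonnegative: trivial
      have h4 : 0 ≤ α * PA := mul_nonneg ha hPA0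
      have h5 : 0 ≤ β' * PB := mul_nonneg hb hPB0
      linarith
    · -- α ≥ 0 > β': G ≥ β'·M·λ' + (1+ε)λλ' ≥ −λ·M·λ' + (1+ε)λλ' = V_min·λλ' ≥ 0
      push Not at hb
      have h1 : β' * (M * lB) ≤ β' * PB := mul_le_mul_of_nonpos_left hPB1 hb.le
      have h3 : -lA * (M * lB) ≤ β' * (M * lB) :=
        mul_le_mul_of_nonneg_right hβl (mul_nonneg hM0 hlB0.le)
      have h4 : 0 ≤ α * PA := mul_nonneg ha hPA0
      linarith
  · push Not at ha
    by_cases hb : 0 ≤ β'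
    · -- β' ≥ 0 > α: symmetric
      have h1 : α * (M * lA) ≤ α * PA := mul_le_mul_of_nonpos_left hPA1 ha.le
      have h3 : -lB * (M * lA) ≤ α * (M * lA) :=
        mul_le_mul_of_nonneg_right hαl (mul_nonneg hM0 hlA0.le)
      have h4 : 0 ≤ β' * PB := mul_nonneg hb hPB0
      have hVm' : (1 + ε) * lA * lB - lB * (M * lA) = Vmin * lA * lB := by simp only [hM]; ring
      linarith
    · -- both negative: compare with the vertex P1 (σ ≤ 0) or P2 (σ ≥ 0)
      push Not at hb
      set σ := qA * α - qB * β' with hσ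
      by_cases hs : σ ≤ 0
      · -- qA·G = qA·G(P1) + qA α (PA − Mλ) + β'(qA PB − λ'(M nA − (1+ε)λ)) ≥ qA·G(P1) + (Mλ − PA)(−σ)
        have hd : qA * PB - lB * (M * nA - (1 + ε) * lA) ≤ qB * (M * lA - PA) := by
          rw [L1]; linarith
        have hstep : β' * (qB * (M * lA - PA)) ≤
            β' * (qA * PB - lB * (M * nA - (1 + ε) * lA)) :=
          mul_le_mul_of_nonpos_left hd hb.le
        have e : qA * (α * PA + β' * PB + (1 + ε) * lA * lB) =
            (qA * (α * (M * lA)) + β' * (lB * (M * nA - (1 + ε) * lA))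
              + qA * ((1 + ε) * lA * lB))
            + qA * α * (PA - M * lA) + β' * (qA * PB - lB * (M * nA - (1 + ε) * lA)) := by
          ring
        have hid : qA * α * (PA - M * lA) + β' * (qB * (M * lA - PA)) =
            (M * lA - PA) * (-σ) := by simp only [hσ]; ring
        have hpos : 0 ≤ (M * lA - PA) * (-σ) := mul_nonneg (by linarith) (by linarith)
        have hkey : 0 ≤ qA * (α * PA + β' * PB + (1 + ε) * lA * lB) := by
          rw [e]; linarith
        by_contra hneg
        push Not at hneg
        have : qA * (α * PA + β' * PB + (1 + ε) * lA * lB) < 0 := mul_neg_of_pos_of_neg hqA hneg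
        linarith
      · -- qB·G = qB·G(P2) + α(qB PA − λ(M nB − (1+ε)λ')) + qB β'(PB − Mλ') ≥ qB·G(P2) + (Mλ' − PB)σ
        push Not at hs
        have hd : qB * PA - lA * (M * nB - (1 + ε) * lB) ≤ qA * (M * lB - PB) := by
          rw [L2]; linarith
        have hstep : α * (qA * (M * lB - PB)) ≤
            α * (qB * PA - lA * (M * nB - (1 + ε) * lB)) :=
          mul_le_mul_of_nonpos_left hd ha.le
        have e : qB * (α * PA + β' * PB + (1 + ε) * lA * lB) =
            (α * (lA * (M * nB - (1 + ε) * lB)) + qB * (β' * (M * lB))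
              + qB * ((1 + ε) * lA * lB))
            + α * (qB * PA - lA * (M * nB - (1 + ε) * lB)) + qB * β' * (PB - M * lB) := by
          ring
        have hid : α * (qA * (M * lB - PB)) + qB * β' * (PB - M * lB) =
            (M * lB - PB) * σ := by simp only [hσ]; ring
        have hpos : 0 ≤ (M * lB - PB) * σ := mul_nonneg (by linarith) hs.le
        have hkey : 0 ≤ qB * (α * PA + β' * PB + (1 + ε) * lA * lB) := by
          rw [e]; linarith
        by_contra hneg
        push Not at hneg
        have : qB * (α * PA + β' * PB + (1 + ε) * lA * lB) < 0 := mul_neg_of_pos_of_neg hqB hneg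
        linarith

end Summit.MatrixMultiplication.MatrixMultiplication.Theorems.FarEdgeDescentTreeCapTools
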